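import Summits.Ventures.HodgeRepro2.T5SU11ResolventBoundary
import Summits.Ventures.HodgeRepro2.T5SU11SphericalDecayBracket
import Summits.Ventures.HodgeRepro2.T5SU11ResolventIdentity
import Summits.Ventures.HodgeRepro2.T5SU11GreenIdentityInhomogeneous
import Summits.Ventures.HodgeRepro2.T5SU11RadialGreenImproperDecaySource

/-!
# The three Lagrange integrals of the kernel computation

For `λ, λ₂ > 1` the products of the basis solutions at the two parameters integrate in closed form against
`sinh 2r` by the Lagrange identity `(sinh 2r (v u′ − u v′))′ = (μ − μ₂) u v sinh 2r` (row 472's bracket with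
`f = 0`):

* **`integral_sph_mul_sph`** — `∫_0^t φ_λ φ_{λ₂} sinh 2r dr = W_{φφ}(t)/(μ − μ₂)` with
  `W_{φφ} = sinh 2r (φ_{λ₂} φ_λ′ − φ_λ φ_{λ₂}′)` (the bracket vanishes at `0`);
* **`integral_sphDecay_mul_sph`** — `∫_t^s χ_λ φ_{λ₂} sinh 2r dr = (W_{χφ}(s) − W_{χφ}(t))/(μ − μ₂)`;
* **`integral_sphDecay_mul_sphDecay_Ioi`** — `∫_{(s,∞)} χ_λ χ_{λ₂} sinh 2r dr = −W_{χχ}(s)/(μ − μ₂)`, because the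
  mixed bracket at infinity vanishes: **`sinh 2R χ_{λ₂}(R) χ_λ′(R) → 0`** (`tendsto_sinh_mul_sphDecay_mul_sphDecay'_mixed`:
  `χ_λ′ = φ_λ′ T_λ − 1/(sinh 2R φ_λ)` and `sinh 2R φ_λ′ = μ ∫_0^R sinh 2u φ_λ`, against the exponential rates of
  `χ_{λ₂}`, `T_λ` and `∫_0^R sinh φ_λ`), and `χ_λ χ_{λ₂} sinh 2r` is integrable on `(s, ∞)`
  (`integrableOn_sphDecay_mul_sphDecay_mul_sinh`).

These are the ingredients of the kernel resolvent identity of the next row. Nothing is claimed about (N).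

Blind lane: Mathlib + the HodgeRepro2 prefix only; no sorry; axioms ⊆ {propext, Classical.choice,
Quot.sound}.
-/

namespace Summit.Ventures.HodgeRepro2.T5SU11KernelBracket

open Filter Topology MeasureTheory intervalIntegral
open Set (Ioi Ioc Icc Ioo)
open T5SU11Cartan T5SU11SphericalFunction T5SU11SphericalBounds T5SU11SphericalContinuous
  T5SU11SphericalSolutionSpaceAll T5SU11SphericalAsymptotic T5SU11SphericalCfun T5SU11SphericalDecay
  T5SU11SphericalDecayAsymptotic T5SU11SphericalDecayBracket T5SU11ReductionOfOrder T5SU11ReductionOfOrderInfinity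
  T5SU11ResolventBoundary T5SU11ResolventIdentity T5SU11GreenIdentityInhomogeneous
  T5SU11RadialGreenImproperDecaySource

section measure

variable [MeasurableSpace Circle] [BorelSpace Circle]

variable {lam lam₂ : ℝ} (hlam : 1 < lam) (hlam₂ : 1 < lam₂)

/-! ### The mixed bracket at infinity -/

include hlam hlam₂ in
/-- **`sinh 2R · χ_{λ₂}(R) χ_λ′(R) → 0`** as `R → ∞`, for all `λ, λ₂ > 1`. -/
theorem tendsto_sinh_mul_sphDecay_mul_sphDecay'_mixed :
    Tendsto (fun R => Real.sinh (2 * R) * (sphDecay lam₂ R * sphDecay' lam R)) atTop (𝓝 0) := by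
  -- the identity `sinh 2R χ_{λ₂} χ_λ′ = μ χ_{λ₂} T_λ ∫_0^R sinh φ_λ − χ_{λ₂}/φ_λ` on `(0, ∞)`
  have hid : ∀ R, 0 < R → Real.sinh (2 * R) * (sphDecay lam₂ R * sphDecay' lam R)
      = lam * (lam - 2) * (sphDecay lam₂ R * tailIntegral (fun t => sph lam (hyp t)) R
          * ∫ u in (0 : ℝ)..R, Real.sinh (2 * u) * sph lam (hyp u))
        - sphDecay lam₂ R / sph lam (hyp R) := by
    intro R hR
    have hφ : 0 < sph lam (hyp R) := sph_hyp_pos lam R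
    have hs : 0 < Real.sinh (2 * R) := sinh_two_mul_pos hR
    rw [sphDecay'_eq hlam hR]
    have hdiv := sinh_mul_deriv_sph_hyp_eq lam R
    have e1 : Real.sinh (2 * R) * (Real.sinh (2 * R) * sph lam (hyp R))⁻¹ = (sph lam (hyp R))⁻¹ := by
      rw [mul_inv, ← mul_assoc, mul_inv_cancel₀ hs.ne', one_mul]
    calc Real.sinh (2 * R) * (sphDecay lam₂ R * (deriv (fun t => sph lam (hyp t)) R
          * tailIntegral (fun t => sph lam (hyp t)) R - (Real.sinh (2 * R) * sph lam (hyp R))⁻¹))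
        = sphDecay lam₂ R * tailIntegral (fun t => sph lam (hyp t)) R
            * (Real.sinh (2 * R) * deriv (fun t => sph lam (hyp t)) R)
          - sphDecay lam₂ R * (Real.sinh (2 * R) * (Real.sinh (2 * R) * sph lam (hyp R))⁻¹) := by ring
      _ = sphDecay lam₂ R * tailIntegral (fun t => sph lam (hyp t)) R
            * (lam * (lam - 2) * ∫ u in (0 : ℝ)..R, Real.sinh (2 * u) * sph lam (hyp u))
          - sphDecay lam₂ R * (sph lam (hyp R))⁻¹ := by rw [hdiv, e1]
      _ = lam * (lam - 2) * (sphDecay lam₂ R * tailIntegral (fun t => sph lam (hyp t)) R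
            * ∫ u in (0 : ℝ)..R, Real.sinh (2 * u) * sph lam (hyp u))
          - sphDecay lam₂ R / sph lam (hyp R) := by rw [div_eq_mul_inv]; ring
  -- the two limits
  have h2 : Tendsto (fun R => sphDecay lam₂ R / sph lam (hyp R)) atTop (𝓝 0) :=
    tendsto_sphDecay_div_sph_hyp_atTop hlam hlam₂
  have h1 : Tendsto (fun R => lam * (lam - 2) * (sphDecay lam₂ R * tailIntegral (fun t => sph lam (hyp t)) R
      * ∫ u in (0 : ℝ)..R, Real.sinh (2 * u) * sph lam (hyp u))) atTop (𝓝 0) := by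
    -- rates: `χ_{λ₂} ≤ 2L₂ e^{−λ₂ R}`, `T_λ ≤ 2K e^{−2(λ−1)R}`, `∫_0^R sinh φ_λ ≤ C₀ + R c e^{λR}`
    set L₂ := 1 / ((lam₂ - 1) * cfun (2 - lam₂)) with hL₂
    have hL₂pos : 0 < L₂ := sphDecay_limit_pos hlam₂
    set K := 1 / ((lam - 1) * cfun (2 - lam) ^ 2) with hK
    have hc : 0 < cfun (2 - lam) := cfun_pos (by linarith)
    have hKpos : 0 < K := by positivity
    obtain ⟨C₀, hC₀, hC⟩ := exists_eventually_integral_sinh_sph_le hlam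
    have hT : ∀ᶠ R in atTop, tailIntegral (fun t => sph lam (hyp t)) R ≤ 2 * K * Real.exp (-(2 * (lam - 1)) * R) := by
      have h := (tendsto_exp_mul_tailIntegral_sph hlam).eventually (eventually_le_nhds (by linarith : K < 2 * K))
      filter_upwards [h] with R hR
      have hE : 0 < Real.exp (2 * (lam - 1) * R) := Real.exp_pos _
      rw [show Real.exp (-(2 * (lam - 1)) * R) = (Real.exp (2 * (lam - 1) * R))⁻¹ by
        rw [← Real.exp_neg]; congr 1; ring]
      rw [le_mul_inv_iff₀ hE, mul_comm]
      exact hR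
    have hlim : Tendsto (fun R => |lam * (lam - 2)| * (2 * L₂ * 2 * K
        * (C₀ * Real.exp (-(lam₂ + 2 * (lam - 1)) * R)
          + cfun (2 - lam) * (R * Real.exp (-(lam₂ + lam - 2) * R))))) atTop (𝓝 0) := by
      have ha : Tendsto (fun R : ℝ => Real.exp (-(lam₂ + 2 * (lam - 1)) * R)) atTop (𝓝 0) :=
        Real.tendsto_exp_neg_atTop_nhds_zero.comp (tendsto_id.const_mul_atTop (by linarith : 0 < lam₂ + 2 * (lam - 1)))
          |>.congr (fun R => by simp only [Function.comp_def, id]; ring_nf)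
      have hb : Tendsto (fun R : ℝ => R * Real.exp (-(lam₂ + lam - 2) * R)) atTop (𝓝 0) :=
        tendsto_mul_exp_neg_mul_atTop (by linarith)
      have := ((ha.const_mul C₀).add (hb.const_mul (cfun (2 - lam)))).const_mul (2 * L₂ * 2 * K)
        |>.const_mul |lam * (lam - 2)|
      simpa using this
    refine squeeze_zero_norm' ?_ hlim
    filter_upwards [eventually_gt_atTop 0, eventually_sphDecay_le hlam₂, hT, hC] with R hR hχ hTR hCR
    have hχ0 : 0 ≤ sphDecay lam₂ R := (sphDecay_pos hlam₂ hR).le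
    have hT0 : 0 ≤ tailIntegral (fun t => sph lam (hyp t)) R := tailIntegral_sph_nonneg hlam hR
    have hI0 : 0 ≤ ∫ u in (0 : ℝ)..R, Real.sinh (2 * u) * sph lam (hyp u) :=
      intervalIntegral.integral_nonneg hR.le (fun u hu => sinh_mul_sph_hyp_nonneg lam hu.1)
    rw [Real.norm_eq_abs, abs_mul, abs_of_nonneg (by positivity : 0 ≤ sphDecay lam₂ R
      * tailIntegral (fun t => sph lam (hyp t)) R * ∫ u in (0 : ℝ)..R, Real.sinh (2 * u) * sph lam (hyp u))]
    apply mul_le_mul_of_nonneg_left _ (abs_nonneg _)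
    calc sphDecay lam₂ R * tailIntegral (fun t => sph lam (hyp t)) R
          * ∫ u in (0 : ℝ)..R, Real.sinh (2 * u) * sph lam (hyp u)
        ≤ (2 * L₂ * Real.exp (-lam₂ * R)) * (2 * K * Real.exp (-(2 * (lam - 1)) * R))
          * (C₀ + R * (cfun (2 - lam) * Real.exp (lam * R))) := by
          apply mul_le_mul (mul_le_mul hχ hTR hT0 (by positivity)) hCR hI0 (by positivity)
      _ = 2 * L₂ * 2 * K * (C₀ * (Real.exp (-lam₂ * R) * Real.exp (-(2 * (lam - 1)) * R))
          + cfun (2 - lam) * (R * (Real.exp (-lam₂ * R) * Real.exp (-(2 * (lam - 1)) * R)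
            * Real.exp (lam * R)))) := by ring
      _ = 2 * L₂ * 2 * K * (C₀ * Real.exp (-(lam₂ + 2 * (lam - 1)) * R)
          + cfun (2 - lam) * (R * Real.exp (-(lam₂ + lam - 2) * R))) := by
          have ea : Real.exp (-lam₂ * R) * Real.exp (-(2 * (lam - 1)) * R)
              = Real.exp (-(lam₂ + 2 * (lam - 1)) * R) := by
            rw [← Real.exp_add]; congr 1; ring
          have eb : Real.exp (-lam₂ * R) * Real.exp (-(2 * (lam - 1)) * R) * Real.exp (lam * R)
              = Real.exp (-(lam₂ + lam - 2) * R) := by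
            rw [← Real.exp_add, ← Real.exp_add]; congr 1; ring
          rw [eb, ea]
  have h := h1.sub h2
  rw [sub_zero] at h
  refine h.congr' ?_
  filter_upwards [eventually_gt_atTop 0] with R hR
  exact (hid R hR).symm

include hlam hlam₂ in
/-- **The mixed bracket `W_{χχ}(R) = sinh 2R (χ_{λ₂} χ_λ′ − χ_λ χ_{λ₂}′) → 0`** as `R → ∞`. -/
theorem tendsto_bracket_sphDecay_sphDecay :
    Tendsto (fun R => Real.sinh (2 * R) * (sphDecay lam₂ R * sphDecay' lam R - sphDecay lam R * sphDecay' lam₂ R))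
      atTop (𝓝 0) := by
  have h := (tendsto_sinh_mul_sphDecay_mul_sphDecay'_mixed hlam hlam₂).sub
    (tendsto_sinh_mul_sphDecay_mul_sphDecay'_mixed hlam₂ hlam)
  rw [sub_zero] at h
  refine h.congr (fun R => ?_)
  ring

/-! ### The three Lagrange integrals -/

/-- `deriv (φ_λ ∘ a)` is continuous on `ℝ`. -/
theorem continuous_deriv_sph_hyp (lam : ℝ) : Continuous (deriv fun t => sph lam (hyp t)) :=
  continuous_iff_continuousAt.mpr fun t => (hasDerivAt_deriv_sph_hyp lam t).continuousAt

include hlam in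
/-- The radial equation of `χ_λ` in the inhomogeneous form with source `0`. -/
theorem sphDecay_ode_zero : ∀ t, 0 < t → Real.sinh (2 * t) * sphDecay'' lam t + 2 * Real.cosh (2 * t) * sphDecay' lam t
    = lam * (lam - 2) * Real.sinh (2 * t) * sphDecay lam t + Real.sinh (2 * t) * (fun _ : ℝ => (0 : ℝ)) t :=
  fun t ht => by rw [sphDecay_ode hlam ht]; ring

/-- The radial equation of `φ_λ` in the inhomogeneous form with source `0`. -/
theorem sph_ode_zero (lam : ℝ) : ∀ t, 0 < t → Real.sinh (2 * t) * deriv (deriv fun t => sph lam (hyp t)) t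
    + 2 * Real.cosh (2 * t) * deriv (fun t => sph lam (hyp t)) t
    = lam * (lam - 2) * Real.sinh (2 * t) * sph lam (hyp t) + Real.sinh (2 * t) * (fun _ : ℝ => (0 : ℝ)) t :=
  fun t ht => by rw [hode_sph lam t ht]; ring

/-- **`(μ − μ₂) ∫_0^t φ_λ φ_{λ₂} sinh 2r dr = sinh 2t (φ_{λ₂} φ_λ′ − φ_λ φ_{λ₂}′)(t)`** for `t ≥ 0`. -/
theorem integral_sph_mul_sph (lam lam₂ : ℝ) {t : ℝ} (ht : 0 ≤ t) :
    (lam * (lam - 2) - lam₂ * (lam₂ - 2)) * ∫ r in (0 : ℝ)..t, sph lam (hyp r) * sph lam₂ (hyp r) * Real.sinh (2 * r)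
      = Real.sinh (2 * t) * (sph lam₂ (hyp t) * deriv (fun t => sph lam (hyp t)) t
          - sph lam (hyp t) * deriv (fun t => sph lam₂ (hyp t)) t) := by
  set W : ℝ → ℝ := fun r => Real.sinh (2 * r) * (sph lam₂ (hyp r) * deriv (fun t => sph lam (hyp t)) r
    - sph lam (hyp r) * deriv (fun t => sph lam₂ (hyp t)) r) with hW
  have hcont : Continuous W := by
    rw [hW]
    exact (Real.continuous_sinh.comp (continuous_const.mul continuous_id)).mul
      (((continuous_sph_hyp lam₂).mul (continuous_deriv_sph_hyp lam)).sub
        ((continuous_sph_hyp lam).mul (continuous_deriv_sph_hyp lam₂)))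
  have hderiv : ∀ r ∈ Ioo (0 : ℝ) t, HasDerivWithinAt W
      ((lam * (lam - 2) - lam₂ * (lam₂ - 2)) * (sph lam (hyp r) * sph lam₂ (hyp r) * Real.sinh (2 * r))) (Ioi r) r := by
    intro r hr
    have h := hasDerivAt_green_bracket (hφ_sph lam) (hφ'_sph lam) (sph_ode_zero lam) (hφ_sph lam₂) (hφ'_sph lam₂)
      (hode_sph lam₂) hr.1
    have e : (fun _ : ℝ => (0 : ℝ)) r * sph lam₂ (hyp r) * Real.sinh (2 * r)
        + (lam * (lam - 2) - lam₂ * (lam₂ - 2)) * (sph lam (hyp r) * sph lam₂ (hyp r) * Real.sinh (2 * r))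
        = (lam * (lam - 2) - lam₂ * (lam₂ - 2)) * (sph lam (hyp r) * sph lam₂ (hyp r) * Real.sinh (2 * r)) := by
      simp
    exact (h.congr_deriv e).hasDerivWithinAt
  have hint : IntervalIntegrable (fun r => (lam * (lam - 2) - lam₂ * (lam₂ - 2))
      * (sph lam (hyp r) * sph lam₂ (hyp r) * Real.sinh (2 * r))) volume 0 t :=
    (continuous_const.mul (((continuous_sph_hyp lam).mul (continuous_sph_hyp lam₂)).mul
      (Real.continuous_sinh.comp (continuous_const.mul continuous_id)))).intervalIntegrable _ _
  have h := integral_eq_sub_of_hasDeriv_right_of_le ht hcont.continuousOn hderiv hint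
  rw [intervalIntegral.integral_const_mul] at h
  rw [h, hW]
  simp

include hlam in
/-- **`(μ − μ₂) ∫_t^s χ_λ φ_{λ₂} sinh 2r dr = W_{χφ}(s) − W_{χφ}(t)`**, `W_{χφ} = sinh 2r (φ_{λ₂} χ_λ′ − χ_λ φ_{λ₂}′)`,
for `0 < t ≤ s`. -/
theorem integral_sphDecay_mul_sph (lam₂ : ℝ) {t s : ℝ} (ht : 0 < t) (hts : t ≤ s) :
    (lam * (lam - 2) - lam₂ * (lam₂ - 2)) * ∫ r in t..s, sphDecay lam r * sph lam₂ (hyp r) * Real.sinh (2 * r)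
      = Real.sinh (2 * s) * (sph lam₂ (hyp s) * sphDecay' lam s - sphDecay lam s * deriv (fun t => sph lam₂ (hyp t)) s)
        - Real.sinh (2 * t) * (sph lam₂ (hyp t) * sphDecay' lam t
          - sphDecay lam t * deriv (fun t => sph lam₂ (hyp t)) t) := by
  have h := green_identity_inhom (fun r hr => hasDerivAt_sphDecay hlam hr) (fun r hr => hasDerivAt_sphDecay' lam hr)
    (sphDecay_ode_zero hlam) (hφ_sph lam₂) (hφ'_sph lam₂) (hode_sph lam₂) continuousOn_const ht hts
  simp only [zero_mul, intervalIntegral.integral_zero] at h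
  linear_combination h

include hlam hlam₂ in
/-- `χ_λ χ_{λ₂} sinh 2r` is integrable on `(s, ∞)` for `s > 0`. -/
theorem integrableOn_sphDecay_mul_sphDecay_mul_sinh {s : ℝ} (hs : 0 < s) :
    IntegrableOn (fun r => sphDecay lam r * sphDecay lam₂ r * Real.sinh (2 * r)) (Ioi s) := by
  -- the source `g(r) = χ_{λ₂}(max r s)` is in the exponentially decaying class at the rate `λ₂ > 2 − λ`
  have hχ : ContinuousOn (sphDecay lam₂) (Ioi 0) :=
    fun _ hr => (hasDerivAt_sphDecay hlam₂ hr).continuousAt.continuousWithinAt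
  have hg : ContinuousOn (fun r => sphDecay lam₂ (max r s)) (Ioi 0) :=
    hχ.comp (continuous_id.max continuous_const).continuousOn (fun r _ => lt_of_lt_of_le hs (le_max_right r s))
  obtain ⟨r₀, hr₀, hmax⟩ := isCompact_Icc.exists_isMaxOn (Set.nonempty_Icc.mpr (le_max_right 1 s))
    (hχ.mono (fun r hr => lt_of_lt_of_le hs hr.1) : ContinuousOn (sphDecay lam₂) (Icc s (max 1 s)))
  have hM : ∀ r ∈ Ioc (0 : ℝ) 1, |sphDecay lam₂ (max r s)| ≤ sphDecay lam₂ r₀ := by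
    intro r hr
    have hmem : max r s ∈ Icc s (max 1 s) := ⟨le_max_right r s, max_le (le_trans hr.2 (le_max_left 1 s)) (le_max_right 1 s)⟩
    rw [abs_of_pos (sphDecay_pos hlam₂ (lt_of_lt_of_le hs (le_max_right r s)))]
    exact (isMaxOn_iff.mp hmax) _ hmem
  have hM0 : 0 ≤ sphDecay lam₂ r₀ := (sphDecay_pos hlam₂ (lt_of_lt_of_le hs hr₀.1)).le
  obtain ⟨T₀, hT₀⟩ := eventually_atTop.mp (eventually_sphDecay_le hlam₂)
  have hC : ∀ r, max T₀ s ≤ r → |sphDecay lam₂ (max r s)|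
      ≤ 2 * (1 / ((lam₂ - 1) * cfun (2 - lam₂))) * Real.exp (-lam₂ * r) := by
    intro r hr
    have hrs : s ≤ r := le_trans (le_max_right _ _) hr
    rw [max_eq_left hrs, abs_of_pos (sphDecay_pos hlam₂ (lt_of_lt_of_le hs hrs))]
    exact hT₀ r (le_trans (le_max_left _ _) hr)
  have hI := integrableOn_sphDecay_mul_mul_sinh hlam hg hM hM0 (by linarith : 2 - lam < lam₂) hC
  refine (hI.mono_set (Set.Ioi_subset_Ioi hs.le)).congr_fun ?_ measurableSet_Ioi
  intro r hr
  simp only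
  rw [max_eq_left (le_of_lt hr)]

include hlam hlam₂ in
/-- **`(μ − μ₂) ∫_{(s,∞)} χ_λ χ_{λ₂} sinh 2r dr = −W_{χχ}(s)`**, `W_{χχ} = sinh 2r (χ_{λ₂} χ_λ′ − χ_λ χ_{λ₂}′)`, for
`s > 0`. -/
theorem integral_sphDecay_mul_sphDecay_Ioi {s : ℝ} (hs : 0 < s) :
    (lam * (lam - 2) - lam₂ * (lam₂ - 2)) * ∫ r in Ioi s, sphDecay lam r * sphDecay lam₂ r * Real.sinh (2 * r)
      = -(Real.sinh (2 * s) * (sphDecay lam₂ s * sphDecay' lam s - sphDecay lam s * sphDecay' lam₂ s)) := by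
  set W : ℝ → ℝ := fun r => Real.sinh (2 * r) * (sphDecay lam₂ r * sphDecay' lam r - sphDecay lam r * sphDecay' lam₂ r)
    with hW
  -- on `[s, R]`
  have hfin : ∀ R, s ≤ R → (lam * (lam - 2) - lam₂ * (lam₂ - 2))
      * ∫ r in s..R, sphDecay lam r * sphDecay lam₂ r * Real.sinh (2 * r) = W R - W s := by
    intro R hR
    have h := green_identity_inhom (fun r hr => hasDerivAt_sphDecay hlam hr) (fun r hr => hasDerivAt_sphDecay' lam hr)
      (sphDecay_ode_zero hlam) (fun r hr => hasDerivAt_sphDecay hlam₂ hr) (fun r hr => hasDerivAt_sphDecay' lam₂ hr)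
      (fun r hr => sphDecay_ode hlam₂ hr) continuousOn_const hs hR
    simp only [zero_mul, intervalIntegral.integral_zero] at h
    rw [hW]
    linear_combination h
  -- `R → ∞`
  have h1 : Tendsto (fun R => (lam * (lam - 2) - lam₂ * (lam₂ - 2))
      * ∫ r in s..R, sphDecay lam r * sphDecay lam₂ r * Real.sinh (2 * r)) atTop
      (𝓝 ((lam * (lam - 2) - lam₂ * (lam₂ - 2))
        * ∫ r in Ioi s, sphDecay lam r * sphDecay lam₂ r * Real.sinh (2 * r))) :=
    (intervalIntegral_tendsto_integral_Ioi s (integrableOn_sphDecay_mul_sphDecay_mul_sinh hlam hlam₂ hs)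
      tendsto_id).const_mul _
  have h2 : Tendsto (fun R => W R - W s) atTop (𝓝 (0 - W s)) :=
    (tendsto_bracket_sphDecay_sphDecay hlam hlam₂).sub tendsto_const_nhds
  have h3 : Tendsto (fun R => (lam * (lam - 2) - lam₂ * (lam₂ - 2))
      * ∫ r in s..R, sphDecay lam r * sphDecay lam₂ r * Real.sinh (2 * r)) atTop (𝓝 (0 - W s)) := by
    refine h2.congr' ?_
    filter_upwards [eventually_ge_atTop s] with R hR
    exact (hfin R hR).symm
  have := tendsto_nhds_unique h1 h3
  rw [this, zero_sub, hW]

end measure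

end Summit.Ventures.HodgeRepro2.T5SU11KernelBracket
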